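import Literature.Barriers.Parity.SiegelZeroPrimePairsProofs
import Literature.NumberTheory.LFunctions.DirichletCharacterCRT
import HarnessLib

/-!
# The level of a primitive quadratic character: `q = 2^r q'` with `r ∈ {0, 2, 3}`

Sibling of `Literature/Barriers/Parity/SiegelZeroPrimePairsProofs.lean`, whose namespace
`Literature.Barriers.Parity.SiegelCorr` proves, for a PRIMITIVE QUADRATIC Dirichlet character
mod `q = 2^r q'` (`q'` odd), that `q'` is squarefree (`SiegelCorr.squarefree_oddPart`) and
`16 ∤ q` (`SiegelCorr.not_sixteen_dvd`, i.e. `r ≤ 3`). This file adds the missing case `r ≠ 1`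
— there is no primitive character at all to a modulus `q ≡ 2 (mod 4)`, because its
Chinese-remainder component mod `2` (the tree's `Literature.NumberTheory.LFunctions.crtFst`,
primitive by `isPrimitive_crtFst`) would be a primitive character mod `2`, and every character
mod `2` is trivial — and packages the conclusion `r ∈ {0, 2, 3}` ("Since `χ` is a primitive
quadratic character of modulus `q = 2^r q'` with `2 ∤ q'`, we have that `r ∈ {0, 2, 3}` and `q'`
is square-free", Matomäki–Merikoski, arXiv:2112.11412, §3.4, the first step of the proof of
their Lemma 2.5), together with the elementary bookkeeping of the decomposition
`q = 2^{v₂(q)} · (q / 2^{v₂(q)})` in the `padicValNat` form used by the tree's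
`Literature.Barriers.Parity.MatomakiMerikoski2023_pairCorrelation`. Everything here is PROVED
(theorems only).

* `SiegelCorr.eq_one_of_level_two` — every Dirichlet character mod `2` is `1`;
* `SiegelCorr.padicValNat_two_ne_one` — a primitive character mod `q` has `v₂(q) ≠ 1`;
* `SiegelCorr.padicValNat_two_mem` — a primitive quadratic character mod `q` has
  `v₂(q) ∈ {0, 2, 3}`;
* `SiegelCorr.two_pow_mul_oddPart`, `coprime_two_pow_oddPart`, `oddPart_pos`, `odd_oddPart`,
  `primeFactors_eq_insert_two`, `primeFactors_filter_not_dvd_eq_oddPart` — the decomposition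
  `q = 2^r q'` and its prime factors (for even `h`, the primes `p ∣ q`, `p ∤ h` are the primes
  `p ∣ q'`, `p ∤ h`, the index set of the correction factor of Theorem 1.3).

## References

* K. Matomäki, J. Merikoski, *Siegel zeros, twin primes, Goldbach's conjecture, and primes in
  short intervals*, IMRN 2023:23, 20337–20384 (arXiv:2112.11412), §3.4 (first sentence of the
  proof of Lemma 2.5). [cite: MatomakiMerikoski2023, §3.4]
* H. L. Montgomery, R. C. Vaughan, *Multiplicative Number Theory I*, CUP 2007, §9.1, Lemma 9.3
  (components of a primitive character are primitive; tree:
  `Literature.NumberTheory.LFunctions.isPrimitive_crtFst`). [cite: MontgomeryVaughan2007, Lemma 9.3]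
-/

noncomputable section

open DirichletCharacter Finset
open Literature.NumberTheory.LFunctions (crtFst isPrimitive_crtFst)

namespace Literature.Barriers.Parity.SiegelCorr

variable {R : Type*} [CommRing R]

/-! ### Characters mod `2` -/

/-- Every Dirichlet character mod `2` is trivial (the unit group of `ℤ/2` is trivial).
[folklore] -/
theorem eq_one_of_level_two (χ : DirichletCharacter R 2) : χ = 1 := by
  rw [MulChar.eq_one_iff]
  intro a
  have hcases : ∀ x : ZMod 2, x = 0 ∨ x = 1 := by decide
  rcases hcases (a : ZMod 2) with h0 | h1
  · exact absurd (h0 ▸ a.isUnit) not_isUnit_zero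
  · rw [h1, map_one]

/-- There is no primitive Dirichlet character mod `2`. [folklore] -/
theorem not_isPrimitive_level_two (χ : DirichletCharacter R 2) : ¬ χ.IsPrimitive := by
  intro h
  rw [isPrimitive_def, eq_one_of_level_two χ, conductor_one] at h
  exact absurd h (by norm_num)

/-! ### The decomposition `q = 2^r q'` -/

/-- `q = 2^r q'` with `r = v₂(q)` and `q' = q / 2^r` the odd part. [folklore] -/
theorem two_pow_mul_oddPart (q : ℕ) : 2 ^ padicValNat 2 q * (q / 2 ^ padicValNat 2 q) = q := by
  rw [← Nat.factorization_def q Nat.prime_two]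
  exact Nat.ordProj_mul_ordCompl_eq_self q 2

/-- `2^r` is coprime to the odd part `q'`. [folklore] -/
theorem coprime_two_pow_oddPart (q : ℕ) [NeZero q] :
    (2 ^ padicValNat 2 q).Coprime (q / 2 ^ padicValNat 2 q) := by
  rw [← Nat.factorization_def q Nat.prime_two]
  exact (Nat.coprime_ordCompl Nat.prime_two (NeZero.ne q)).pow_left _

/-- The odd part is positive. [folklore] -/
theorem oddPart_pos (q : ℕ) [NeZero q] : 0 < q / 2 ^ padicValNat 2 q := by
  rw [← Nat.factorization_def q Nat.prime_two]
  exact Nat.ordCompl_pos 2 (NeZero.ne q)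

/-- The odd part is odd. [folklore] -/
theorem odd_oddPart (q : ℕ) [NeZero q] : _root_.Odd (q / 2 ^ padicValNat 2 q) :=
  Nat.odd_iff.mpr (Nat.two_dvd_ne_zero.mp (two_not_dvd_oddPart q))

/-- Prime factors of `2^k q'` for `q'` odd and `k ≠ 0`. [folklore] -/
theorem primeFactors_two_pow_mul {k q' : ℕ} (hk : k ≠ 0) (hodd : _root_.Odd q') :
    (2 ^ k * q').primeFactors = insert 2 q'.primeFactors := by
  have hcop : (2 ^ k).Coprime q' := (Nat.coprime_two_left.mpr hodd).pow_left k
  rw [Nat.Coprime.primeFactors_mul hcop, Nat.primeFactors_prime_pow hk Nat.prime_two,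
    Finset.insert_eq]

/-- For even `q`, the prime factors of `q` are `2` and those of the odd part. [folklore] -/
theorem primeFactors_eq_insert_two (q : ℕ) [NeZero q] (hq : 2 ∣ q) :
    q.primeFactors = insert 2 (q / 2 ^ padicValNat 2 q).primeFactors := by
  have hr : padicValNat 2 q ≠ 0 := by
    haveI : Fact (Nat.Prime 2) := ⟨Nat.prime_two⟩
    exact Nat.one_le_iff_ne_zero.mp (one_le_padicValNat_of_dvd (NeZero.ne q) hq)
  conv_lhs => rw [← two_pow_mul_oddPart q]
  exact primeFactors_two_pow_mul hr (odd_oddPart q)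

/-- For even `h`, the prime factors of `q` not dividing `h` are those of the odd part `q'` not
dividing `h` — the index set `{p ∣ q', p ∤ h}` of the correction factor of Matomäki–Merikoski's
Theorem 1.3. [folklore] -/
theorem primeFactors_filter_not_dvd_eq_oddPart (q : ℕ) [NeZero q] {h : ℕ} (hh : _root_.Even h) :
    q.primeFactors.filter (fun p => ¬ p ∣ h) =
      (q / 2 ^ padicValNat 2 q).primeFactors.filter (fun p => ¬ p ∣ h) := by
  have hq := two_pow_mul_oddPart q
  have h2 : 2 ∣ h := even_iff_two_dvd.mp hh
  have hq'0 : q / 2 ^ padicValNat 2 q ≠ 0 := (oddPart_pos q).ne'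
  ext p
  simp only [Finset.mem_filter, Nat.mem_primeFactors, ne_eq]
  constructor
  · rintro ⟨⟨hp, hpq, -⟩, hph⟩
    have hp2 : p ≠ 2 := fun h => hph (h ▸ h2)
    have hcop : p.Coprime (2 ^ padicValNat 2 q) :=
      (Nat.coprime_primes hp Nat.prime_two |>.mpr hp2).pow_right _
    refine ⟨⟨hp, ?_, hq'0⟩, hph⟩
    rw [← hq] at hpq
    exact hcop.dvd_of_dvd_mul_left hpq
  · rintro ⟨⟨hp, hpq', -⟩, hph⟩
    exact ⟨⟨hp, hpq'.trans (Nat.div_dvd_of_dvd pow_padicValNat_dvd), NeZero.ne q⟩, hph⟩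

/-! ### No primitive character has `2 ∥ q` -/

/-- The first CRT component of a primitive character at a propositional level `q = q₁ q₂` is a
primitive character mod `q₁` (packaging of the tree's `isPrimitive_crtFst` for use when `q` is
not syntactically a product). [cite: MontgomeryVaughan2007, Lemma 9.3] -/
theorem exists_isPrimitive_level_fst {q q₁ q₂ : ℕ} [NeZero q₁] [NeZero q₂] (hq : q₁ * q₂ = q)
    (hc : q₁.Coprime q₂) (χ : DirichletCharacter R q) (hχ : χ.IsPrimitive) :
    ∃ χ₁ : DirichletCharacter R q₁, χ₁.IsPrimitive := by
  subst hq
  exact ⟨crtFst hc χ, isPrimitive_crtFst hc hχ⟩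

/-- **No primitive character to a modulus `q ≡ 2 (mod 4)`**: if `χ` mod `q` is primitive then
`v₂(q) ≠ 1` (otherwise `q = 2 q'` with `q'` odd, and the component of `χ` mod `2` would be a
primitive character mod `2`). [folklore] -/
theorem padicValNat_two_ne_one {q : ℕ} [NeZero q] (χ : DirichletCharacter R q)
    (hprim : χ.IsPrimitive) : padicValNat 2 q ≠ 1 := by
  intro h1
  have hq := two_pow_mul_oddPart q
  have hcop := coprime_two_pow_oddPart q
  have hpos := oddPart_pos q
  rw [h1, pow_one] at hq hcop hpos
  haveI : NeZero (q / 2) := ⟨hpos.ne'⟩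
  obtain ⟨χ₁, hχ₁⟩ := exists_isPrimitive_level_fst hq hcop χ hprim
  exact not_isPrimitive_level_two χ₁ hχ₁

/-- **The `2`-part of the level of a primitive quadratic character**: `v₂(q) ∈ {0, 2, 3}`
("`r ∈ {0, 2, 3}` and `q'` is square-free", the first step of the proof of Matomäki–Merikoski's
Lemma 2.5; `r ≤ 3` is the tree's `SiegelCorr.not_sixteen_dvd`, `r ≠ 1` is
`padicValNat_two_ne_one`). [cite: MatomakiMerikoski2023, §3.4] -/
theorem padicValNat_two_mem {q : ℕ} [NeZero q] (χ : DirichletCharacter R q)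
    (hprim : χ.IsPrimitive) (hquad : χ.IsQuadratic) :
    padicValNat 2 q = 0 ∨ padicValNat 2 q = 2 ∨ padicValNat 2 q = 3 := by
  have hr3 : padicValNat 2 q ≤ 3 := by
    by_contra hlt
    push Not at hlt
    have : 2 ^ 4 ∣ q := (pow_dvd_pow 2 hlt).trans pow_padicValNat_dvd
    exact not_sixteen_dvd χ hprim hquad (by norm_num at this ⊢; exact this)
  have hr1 := padicValNat_two_ne_one χ hprim
  omega

/-- The level of a primitive quadratic character is `q'`, `4 q'` or `8 q'` with `q' = q / 2^{v₂(q)}`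
odd and squarefree. [cite: MatomakiMerikoski2023, §3.4] -/
theorem level_eq_oddPart_or {q : ℕ} [NeZero q] (χ : DirichletCharacter R q)
    (hprim : χ.IsPrimitive) (hquad : χ.IsQuadratic) :
    q = q / 2 ^ padicValNat 2 q ∨ q = 4 * (q / 2 ^ padicValNat 2 q) ∨
      q = 8 * (q / 2 ^ padicValNat 2 q) := by
  have hq := two_pow_mul_oddPart q
  generalize q / 2 ^ padicValNat 2 q = q' at hq ⊢
  rcases padicValNat_two_mem χ hprim hquad with h | h | h
  · left
    rw [h, pow_zero, one_mul] at hq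
    exact hq.symm
  · right; left
    rw [h] at hq
    norm_num at hq
    exact hq.symm
  · right; right
    rw [h] at hq
    norm_num at hq
    exact hq.symm

end Literature.Barriers.Parity.SiegelCorr
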